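import Summits.QuantumFields.YangMills.Theorems.PencilRigidityDiagonalMirrorRPRCentreClosed

/-!
# Scratch (lead c6): the PROMOTE variant for crux `DiagonalMirrorRPR` (stmt-QuantumFields-10604), as ROUTE-LEVEL terms

Two ways to repair the item are on record; both need a planner.  (A) fold tilted-cover convergence into D
(`RestateCheck.lean`: `DiagonalMirrorRPR_v1/_v2/_v3`, each proved by a landed theorem).  (B) — this file — SPLIT D:
restate D minimally as `DiagonalMirrorRPR_wc` (the filed term with ONE antecedent inserted, the Statement's own
`sch.HasWeakCouplingLimit`, which both existence legs already output) and file the residual transport as a NEW leaf item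
`TiltedCoverConvergenceWC` (route vocabulary only: `tiltedLatticeSchwinger` is Literature, p96664) — the honest
existence-level statement "along a weak-coupling scheme carrying the curvature package, the renormalised curvature strings
converge on the 45°-tilted double covers to the same limit".  `DiagonalMirrorRPR_wc_of_tilted` proves (B) closes D_wc from the
new leaf by the landed v3 closer (p117149); `_pos` variants do the same with the sign clause `∀ᶠ k, 0 ≤ sch.β k` (v1 closer p97653).
Imports needed by a route file adopting any of these terms: `Literature.MathematicalPhysics.QuantumFieldTheory.TiltedTorusLatticeSchwinger`
on top of the current route imports.
-/

open Filter

namespace Summit.QuantumFields.YangMills.Cruxes.DiagonalMirrorRPR.PromoteCheck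

/-- **New leaf item (weak-coupling form)**: W₁ → `sch.HasWeakCouplingLimit` → tilted-cover convergence of the curvature strings on `⁰𝒮`. -/
def TiltedCoverConvergenceWC : Prop :=
  open Literature.MathematicalPhysics.QuantumLattice Literature.MathematicalPhysics.AQFT Literature.MathematicalPhysics.QuantumFieldTheory in let E := EuclideanSpace ℝ (Fin 4); ∀ (G : Type) [Group G] [TopologicalSpace G] [IsTopologicalGroup G] [CompactSpace G], IsCompactSimpleLieGroup G → letI : MeasurableSpace G := borel G; haveI : BorelSpace G := ⟨rfl⟩; let W₁ := fun (r : LatticeRep G) (sch : SpeciesScheme (YMSpecies G)) (S₁ : SchwingerFamily E) => ((∀ (n : ℕ), n ≠ 0 → ∀ (f : Fin n → SchwartzMap (E) ℝ) (F : SchwartzMap (Fin n → E) ℂ), IsTensorOf F (fun i => ofRealTest (f i)) → IsOffDiagonal F → Filter.Tendsto (fun k : ℕ => ((latticeSchwinger r.ρ sch (fun s => s.F) k n (fun _ => r.curvature) f : ℝ) : ℂ)) Filter.atTop (nhds (S₁ n F))) ∧ (S₁.toLabelled.IsNormalized ∧ S₁.toLabelled.IsHermitian ∧ S₁.toLabelled.HasLinearGrowth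 ∧ S₁.toLabelled.IsReflectionPositive ∧ S₁.toLabelled.IsSymmetric ∧ S₁.toLabelled.HasClusterProperty) ∧ (∀ (n : ℕ) (a : E) (F : SchwartzMap (Fin n → E) ℂ), IsOffDiagonal F → S₁ n (translateMulti a F) = S₁ n F) ∧ (∀ (R : E ≃ₗᵢ[ℝ] E), LinearMap.det (R.toLinearEquiv : E →ₗ[ℝ] E) = 1 → (∀ i : Fin 4, ∃ j : Fin 4, R (EuclideanSpace.single i 1) = EuclideanSpace.single j 1 ∨ R (EuclideanSpace.single i 1) = -EuclideanSpace.single j 1) → ∀ (n : ℕ) (F : SchwartzMap (Fin n → E) ℂ), IsOffDiagonal F → S₁ n (linActMulti R F) = S₁ n F) ∧ (∃ Δ : ℝ, 0 < Δ ∧ S₁.toLabelled.HasMassGap Δ ∧ HasLatticeMassGap r sch Δ)); ∀ (r : LatticeRep G) (sch : SpeciesScheme (YMSpecies G)) (S₁ : SchwingerFamily E), W₁ r sch S₁ → sch.HasWeakCouplingLimit → ∀ (n : ℕ), n ≠ 0 → ∀ (f : Fin n → SchwartzMap (E) ℝ) (F : SchwartzMap (Fin n → E) ℂ), IsTensorOf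 F (fun i => ofRealTest (f i)) → IsOffDiagonal F → Filter.Tendsto (fun k : ℕ => ((tiltedLatticeSchwinger r.ρ sch (fun s => s.F) k n (fun _ => r.curvature) f : ℝ) : ℂ)) Filter.atTop (nhds (S₁ n F))

/-- **Minimal restatement of D (weak-coupling form)**: the filed term with `sch.HasWeakCouplingLimit` inserted after `W₁ r sch S₁ →`. -/
def DiagonalMirrorRPR_wc : Prop :=
  open Literature.MathematicalPhysics.QuantumLattice Literature.MathematicalPhysics.AQFT Literature.MathematicalPhysics.QuantumFieldTheory in let E := EuclideanSpace ℝ (Fin 4); ∀ (G : Type) [Group G] [TopologicalSpace G] [IsTopologicalGroup G] [CompactSpace G], IsCompactSimpleLieGroup G → letI : MeasurableSpace G := borel G; haveI : BorelSpace G := ⟨rfl⟩; let W₁ := fun (r : LatticeRep G) (sch : SpeciesScheme (YMSpecies G)) (S₁ : SchwingerFamily E) => ((∀ (n : ℕ), n ≠ 0 → ∀ (f : Fin n → SchwartzMap (E) ℝ) (F : SchwartzMap (Fin n → E) ℂ), IsTensorOf F (fun i => ofRealTest (f i)) → IsOffDiagonal F → Filter.Tendsto (fun k : ℕ => ((latticeSchwinger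 r.ρ sch (fun s => s.F) k n (fun _ => r.curvature) f : ℝ) : ℂ)) Filter.atTop (nhds (S₁ n F))) ∧ (S₁.toLabelled.IsNormalized ∧ S₁.toLabelled.IsHermitian ∧ S₁.toLabelled.HasLinearGrowth ∧ S₁.toLabelled.IsReflectionPositive ∧ S₁.toLabelled.IsSymmetric ∧ S₁.toLabelled.HasClusterProperty) ∧ (∀ (n : ℕ) (a : E) (F : SchwartzMap (Fin n → E) ℂ), IsOffDiagonal F → S₁ n (translateMulti a F) = S₁ n F) ∧ (∀ (R : E ≃ₗᵢ[ℝ] E), LinearMap.det (R.toLinearEquiv : E →ₗ[ℝ] E) = 1 → (∀ i : Fin 4, ∃ j : Fin 4, R (EuclideanSpace.single i 1) = EuclideanSpace.single j 1 ∨ R (EuclideanSpace.single i 1) = -EuclideanSpace.single j 1) → ∀ (n : ℕ) (F : SchwartzMap (Fin n → E) ℂ), IsOffDiagonal F → S₁ n (linActMulti R F) = S₁ n F) ∧ (∃ Δ : ℝ, 0 < Δ ∧ S₁.toLabelled.HasMassGap Δ ∧ HasLatticeMassGap r sch Δ)); ∀ (r : LatticeRep G) (sch : SpeciesScheme (YMSpecies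 G)) (S₁ : SchwingerFamily E), W₁ r sch S₁ → sch.HasWeakCouplingLimit → ∀ (R : E ≃ₗᵢ[ℝ] E) (a b : ℝ), a ^ 2 = 1 / 2 → b ^ 2 = 1 / 2 → R (EuclideanSpace.single 0 1) = a • EuclideanSpace.single 0 1 + b • EuclideanSpace.single 1 1 → (SchwingerFamily.toLabelled (fun n => (S₁ n).comp (linActMulti R))).IsReflectionPositive

/-- (B) closes: the new leaf gives the minimally restated crux, by the landed v3 closer (p117149). -/
theorem DiagonalMirrorRPR_wc_of_tilted (hT : TiltedCoverConvergenceWC) : DiagonalMirrorRPR_wc :=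
  fun G _ _ _ _ hG r sch S₁ hW hwc =>
    CentreTwistedSwap.Reduction.restatedCruxWeakCoupling_holds G hG r sch S₁ hW hwc (hT G hG r sch S₁ hW hwc)

/-- **New leaf item (sign-clause form)**: W₁ → `∀ᶠ k, 0 ≤ sch.β k` → tilted-cover convergence. -/
def TiltedCoverConvergencePos : Prop :=
  open Literature.MathematicalPhysics.QuantumLattice Literature.MathematicalPhysics.AQFT Literature.MathematicalPhysics.QuantumFieldTheory in let E := EuclideanSpace ℝ (Fin 4); ∀ (G : Type) [Group G] [TopologicalSpace G] [IsTopologicalGroup G] [CompactSpace G], IsCompactSimpleLieGroup G → letI : MeasurableSpace G := borel G; haveI : BorelSpace G := ⟨rfl⟩; let W₁ := fun (r : LatticeRep G) (sch : SpeciesScheme (YMSpecies G)) (S₁ : SchwingerFamily E) => ((∀ (n : ℕ), n ≠ 0 → ∀ (f : Fin n → SchwartzMap (E) ℝ) (F : SchwartzMap (Fin n → E) ℂ), IsTensorOf F (fun i => ofRealTest (f i)) → IsOffDiagonal F → Filter.Tendsto (fun k : ℕ => ((latticeSchwinger r.ρ sch (fun s => s.F) k n (fun _ => r.curvature) f : ℝ)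 : ℂ)) Filter.atTop (nhds (S₁ n F))) ∧ (S₁.toLabelled.IsNormalized ∧ S₁.toLabelled.IsHermitian ∧ S₁.toLabelled.HasLinearGrowth ∧ S₁.toLabelled.IsReflectionPositive ∧ S₁.toLabelled.IsSymmetric ∧ S₁.toLabelled.HasClusterProperty) ∧ (∀ (n : ℕ) (a : E) (F : SchwartzMap (Fin n → E) ℂ), IsOffDiagonal F → S₁ n (translateMulti a F) = S₁ n F) ∧ (∀ (R : E ≃ₗᵢ[ℝ] E), LinearMap.det (R.toLinearEquiv : E →ₗ[ℝ] E) = 1 → (∀ i : Fin 4, ∃ j : Fin 4, R (EuclideanSpace.single i 1) = EuclideanSpace.single j 1 ∨ R (EuclideanSpace.single i 1) = -EuclideanSpace.single j 1) → ∀ (n : ℕ) (F : SchwartzMap (Fin n → E) ℂ), IsOffDiagonal F → S₁ n (linActMulti R F) = S₁ n F) ∧ (∃ Δ : ℝ, 0 < Δ ∧ S₁.toLabelled.HasMassGap Δ ∧ HasLatticeMassGap r sch Δ)); ∀ (r : LatticeRep G) (sch : SpeciesScheme (YMSpecies G)) (S₁ : SchwingerFamily E), W₁ r sch S₁ → (∀ᶠ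 k in Filter.atTop, 0 ≤ sch.β k) → ∀ (n : ℕ), n ≠ 0 → ∀ (f : Fin n → SchwartzMap (E) ℝ) (F : SchwartzMap (Fin n → E) ℂ), IsTensorOf F (fun i => ofRealTest (f i)) → IsOffDiagonal F → Filter.Tendsto (fun k : ℕ => ((tiltedLatticeSchwinger r.ρ sch (fun s => s.F) k n (fun _ => r.curvature) f : ℝ) : ℂ)) Filter.atTop (nhds (S₁ n F))

/-- **Minimal restatement of D (sign-clause form)**: the filed term with `∀ᶠ k in Filter.atTop, 0 ≤ sch.β k` inserted after `W₁ r sch S₁ →`. -/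
def DiagonalMirrorRPR_pos : Prop :=
  open Literature.MathematicalPhysics.QuantumLattice Literature.MathematicalPhysics.AQFT Literature.MathematicalPhysics.QuantumFieldTheory in let E := EuclideanSpace ℝ (Fin 4); ∀ (G : Type) [Group G] [TopologicalSpace G] [IsTopologicalGroup G] [CompactSpace G], IsCompactSimpleLieGroup G → letI : MeasurableSpace G := borel G; haveI : BorelSpace G := ⟨rfl⟩; let W₁ := fun (r : LatticeRep G) (sch : SpeciesScheme (YMSpecies G)) (S₁ : SchwingerFamily E) => ((∀ (n : ℕ), n ≠ 0 → ∀ (f : Fin n → SchwartzMap (E) ℝ) (F : SchwartzMap (Fin n → E) ℂ), IsTensorOf F (fun i => ofRealTest (f i)) → IsOffDiagonal F → Filter.Tendsto (fun k : ℕ => ((latticeSchwinger r.ρ sch (fun s => s.F) k n (fun _ => r.curvature) f : ℝ) : ℂ)) Filter.atTop (nhds (S₁ n F))) ∧ (S₁.toLabelled.IsNormalized ∧ S₁.toLabelled.IsHermitian ∧ S₁.toLabelled.HasLinearGrowth ∧ S₁.toLabelled.IsReflectionPositive ∧ S₁.toLabelled.IsSymmetric ∧ S₁.toLabelled.HasClusterProperty)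 ∧ (∀ (n : ℕ) (a : E) (F : SchwartzMap (Fin n → E) ℂ), IsOffDiagonal F → S₁ n (translateMulti a F) = S₁ n F) ∧ (∀ (R : E ≃ₗᵢ[ℝ] E), LinearMap.det (R.toLinearEquiv : E →ₗ[ℝ] E) = 1 → (∀ i : Fin 4, ∃ j : Fin 4, R (EuclideanSpace.single i 1) = EuclideanSpace.single j 1 ∨ R (EuclideanSpace.single i 1) = -EuclideanSpace.single j 1) → ∀ (n : ℕ) (F : SchwartzMap (Fin n → E) ℂ), IsOffDiagonal F → S₁ n (linActMulti R F) = S₁ n F) ∧ (∃ Δ : ℝ, 0 < Δ ∧ S₁.toLabelled.HasMassGap Δ ∧ HasLatticeMassGap r sch Δ)); ∀ (r : LatticeRep G) (sch : SpeciesScheme (YMSpecies G)) (S₁ : SchwingerFamily E), W₁ r sch S₁ → (∀ᶠ k in Filter.atTop, 0 ≤ sch.β k) → ∀ (R : E ≃ₗᵢ[ℝ] E) (a b : ℝ), a ^ 2 = 1 / 2 → b ^ 2 = 1 / 2 → R (EuclideanSpace.single 0 1) = a • EuclideanSpace.single 0 1 + b • EuclideanSpace.single 1 1 → (SchwingerFamily.toLabelled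 (fun n => (S₁ n).comp (linActMulti R))).IsReflectionPositive

/-- (B') closes: the sign-clause leaf gives the sign-clause crux, by the landed v1 closer (p97653). -/
theorem DiagonalMirrorRPR_pos_of_tilted (hT : TiltedCoverConvergencePos) : DiagonalMirrorRPR_pos :=
  fun G _ _ _ _ hG r sch S₁ hW hpos =>
    ParityBridgeColdTraces.Reduction.restatedCrux_holds G hG r sch S₁ hW hpos (hT G hG r sch S₁ hW hpos)

/-- The weak-coupling leaf follows from the sign-clause leaf (`β_k → +∞` forces `β_k ≥ 0` eventually). -/
theorem tiltedCoverConvergenceWC_of_pos (hT : TiltedCoverConvergencePos) : TiltedCoverConvergenceWC :=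
  fun G _ _ _ _ hG r sch S₁ hW hwc =>
    hT G hG r sch S₁ hW (Filter.Tendsto.eventually_ge_atTop hwc 0)

end Summit.QuantumFields.YangMills.Cruxes.DiagonalMirrorRPR.PromoteCheck
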